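import Mathlib
import Summits.AnomalousDissipation.AnomalousDissipation.Theorems.SolenoidalFractalHomogenisationLagrangianStepW7ThreeModeFibreR
import Summits.AnomalousDissipation.AnomalousDissipation.Theorems.SolenoidalFractalHomogenisationLagrangianStepW7SlotPointwise
import Summits.AnomalousDissipation.AnomalousDissipation.Theorems.SolenoidalFractalHomogenisationLagrangianStepW7EngineSpineAC
import Summits.AnomalousDissipation.AnomalousDissipation.Theorems.SolenoidalFractalHomogenisationLagrangianStepW7SlotAC
import HarnessLib

/-!
# K1L_D (stmt-AnomalousDissipation-27980), (ℓ3) (D-TH)₀ «frozen-frame W7» — THE ABSTRACT SLOT STEP AT REAL WAVE VECTORS WITH GENERIC DAMPINGS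
# `E(t₁) ≤ exp(−I_s)·E(t₀)` (helper; `--supports stmt-AnomalousDissipation-27980 --as helper`)

Port AND generalisation of `W7Slot.slot_step` / `slot_step_on` (`…W7SlotStep`, `…W7SlotStepOn`; this lineage g11) for the twisted port of the W7 engine
(prover ad-sawtooth-k1loc-p1 g16; memo `HOME/ad-sawtooth-k1loc-p1/g16/DTH-costline-k1locp1g16.md` §2, finding F-p1g16-1).  Two changes, both widening:
* the five wave vectors are REAL (`q_j : Fin 3 → ℝ`; flat fibres `q_j = K_j`, frozen-frame fibres `q_j = twistFreq G₀ K_j = G₀ᵀK_j`), the chain ODE is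
  `dW0R/dWpR/dWmR` of `…W7ThreeModeDefsR` (Leray projections `transversalProjR q_j`);
* the dampings `y_j : ℝ → ℂ³` are GENERIC: the slot step only needs, on the slot, transversality of `y_±` (`rdot q_± (y_± t) = 0`), the coercivities
  `d₀‖w₀‖² ≤ Re⟪y₀, w₀⟫`, `dmin‖w_±‖² ≤ Re⟪y_±, w_±⟫`, `dtwo‖w_±±‖² ≤ Re⟪y_±±, w_±±⟫` and the upper bounds `‖y_±‖ ≤ Dmax‖w_±‖`, `‖y₀‖ ≤ D0‖w₀‖` —
  for the flat engine these are `coercivity_modalAdjGen` / `norm_modalAdjGen_le` at `y_j = modalAdjGen 𝔹 K_j w_j`, for the frozen frame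
  `ThreeMode.coercivity_twistGen` / `norm_twistGen_le` at `y_j = 4π²•P_{G₀ᵀK_j} T_{𝔹^{G₀}}(K_j) w_j` with the window numbers moved inside their slack
  (`ThreeMode.le_freqNormSq_twist` / `freqNormSq_twist_le`).
All pointwise hypotheses are asked on the slot `Icc t₀ t₁` only (no clamping wrapper needed).  Proof = the g11 proof verbatim: `threeModeR3_form_le` + remainder +
ramp Young (`W7Slot.pointwise_slot_ineq`, pure real arithmetic, reused) ⇒ `Φ̇ ≤ −σE` for `Φ = E + μεX`; `threeModeR3_equiv` ⇒ `7E/8 ≤ Φ ≤ 9E/8`; `Φ = E` at the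
slot ends; `W7Engine.slot_contraction_ac`.
* `l_mul_Ydot_eq_xdotR` — `l·Ẏ = xdotR` (frozen-`l` derivative of the cross term);
* **`slot_stepR`** — `E t₁ ≤ exp(−∫_{t₀}^{t₁} min(σ/(9/8), σ/(7/8)))·E t₀`, `σ(t) = min(εc²(qA(t)²/2 − 8ε/(dmin(t₁−t₀)²)), min(dmin, dtwo))`, NO prefactor.
No definitions, no sorry.  NOT a proof of any block, of `stub_Vmod_EHTthg`, of K1L_D or of AD; rung F-D1.A0.
[cite: BedrossianCotiZelati2017, §2 (hypocoercivity functional with a cross term, Grönwall)] [problem: turb]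
-/

set_option linter.dupNamespace false

noncomputable section

namespace Summit.AnomalousDissipation.AnomalousDissipation.Theorems.SolenoidalFractalHomogenisation.LagrangianStep.W7Slot

open Set Real MeasureTheory intervalIntegral
open scoped InnerProductSpace
open Literature.Analysis.FluidPDE Literature.Analysis.FluidPDE.Torus
open Summit.AnomalousDissipation.AnomalousDissipation.Theorems.SolenoidalFractalHomogenisation.LagrangianStep.ThreeMode
open Summit.AnomalousDissipation.AnomalousDissipation.Theorems.SolenoidalFractalHomogenisation.LagrangianStep.W7Engine

/-! ## §1 Algebra of the cross term at real wave vectors -/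

/-- The frozen-`l` derivative of the cross term is `xdotR`: with `ẇ₀ = dW0R`, `ẇ₊ = dWpR`, `ẇ₋ = dWmR`,
`l·(Re⟪w₀, P₀(ẇ₊ − ẇ₋)⟫ + Re⟪ẇ₀, P₀(w₊ − w₋)⟫) = xdotR l …`. [cite: BedrossianCotiZelati2017, §2] -/
theorem l_mul_Ydot_eq_xdotR (l : ℝ) (q0 qp qm : Fin 3 → ℝ) (w0 wp wm wpp wmm y0 yp ym : (EuclideanSpace ℂ (Fin 3))) :
    l * ((⟪w0, transversalProjR q0 (dWpR l qp w0 wpp yp - dWmR l qm w0 wmm ym)⟫_ℂ).re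
        + (⟪dW0R l q0 wp wm y0, transversalProjR q0 (wp - wm)⟫_ℂ).re)
      = xdotR l q0 qp qm w0 wp wm wpp wmm y0 yp ym := by
  rw [xdotR, bR, inner_smul_right, inner_smul_right, Complex.re_ofReal_mul, Complex.re_ofReal_mul]
  ring

/-! ## §2 The slot step at real wave vectors with generic dampings -/

/-- **THE ABSTRACT SLOT STEP AT REAL WAVE VECTORS, GENERIC DAMPINGS** (one ramped slot `[t₀, t₁]`, one slow chain `q_j`, |j| ≤ 2, multiplicity `μ`).
DATA on the slot: an absolutely continuous energy `E` with a.e. derivative `−2Q`; the dissipation split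
`Q ≥ μ Σ_{|j|≤2} Re⟪y_j, w_j⟫ + (dmin/2)(E − μ Σ_{|j|≤2}‖w_j‖²)`; absolutely continuous gauged chain modes `w₀, w₊, w₋` with the chain ODE
`dW0R/dWpR/dWmR` a.e. (coupling `l = c·A(t)`, dampings `y₀, y₊, y₋`), values `w₊₊, w₋₋` with dampings `y₊₊, y₋₋`; transversality of `w₀, y₊, y₋`;
coercivity numbers `d₀, dmin, dtwo` and upper bounds `Dmax, D0` of the dampings; a continuous, absolutely continuous envelope `A` vanishing at both ends
with `0 ≤ A ≤ 1` and `Ȧ² ≤ 4/(t₁−t₀)²` a.e.; the drain floor `q‖w₀‖² ≤ ‖P₊w₀‖² + ‖P₋w₀‖²`; the Young constraints (c1)–(c4) at `l_peak = c`.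
CONCLUSION: `E t₁ ≤ exp(−∫_{t₀}^{t₁} min(σ/(9/8), σ/(7/8)))·E t₀`, `σ(t) = min(εc²(qA(t)²/2 − 8ε/(dmin(t₁−t₀)²)), min(dmin, dtwo))`.
[cite: BedrossianCotiZelati2017, §2 (hypocoercivity functional)] -/
theorem slot_stepR {q0 qp qm : Fin 3 → ℝ} {t₀ t₁ : ℝ} (hT : t₀ < t₁)
    {w0 wp wm wpp wmm y0 yp ym ypp ymm : ℝ → (EuclideanSpace ℂ (Fin 3))} {E Q A Ad : ℝ → ℝ}
    {μ c ε q d0 dmin dtwo Dmax D0 : ℝ}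
    (hμ : 0 < μ) (hc : 0 ≤ c) (hε : 0 ≤ ε) (hd0 : 0 ≤ d0) (hdmin : 0 < dmin) (hdtwo : 0 ≤ dtwo) (hD0 : 0 ≤ D0) (hdD : dmin ≤ Dmax)
    -- the Young constraints at `l_peak = c`
    (c1 : 8 * ε * c ^ 2 ≤ dmin) (c2 : 4 * ε * Dmax ^ 2 ≤ dmin) (c3 : ε * c ^ 2 ≤ dtwo) (c4 : 32 * ε ^ 2 * c ^ 2 * D0 ^ 2 ≤ d0 * dmin)
    -- the envelope
    (hAc : Continuous A) (hA01 : ∀ t ∈ Icc t₀ t₁, 0 ≤ A t ∧ A t ≤ 1) (hA0 : A t₀ = 0) (hA1 : A t₁ = 0)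
    (hAac : AbsolutelyContinuousOnInterval A t₀ t₁) (hAd : ∀ᵐ t, t ∈ uIcc t₀ t₁ → HasDerivAt A (Ad t) t)
    (hAd2 : ∀ᵐ t, t ∈ uIcc t₀ t₁ → Ad t ^ 2 ≤ 4 / (t₁ - t₀) ^ 2)
    -- transversality of the slow mode and of the `±1` dampings, on the slot
    (hT0 : ∀ t ∈ Icc t₀ t₁, rdot q0 (w0 t) = 0) (hTyp : ∀ t ∈ Icc t₀ t₁, rdot qp (yp t) = 0) (hTym : ∀ t ∈ Icc t₀ t₁, rdot qm (ym t) = 0)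
    -- coercivity and upper bounds of the dampings, on the slot
    (hg0 : ∀ t ∈ Icc t₀ t₁, d0 * ‖w0 t‖ ^ 2 ≤ (⟪y0 t, w0 t⟫_ℂ).re)
    (hgp : ∀ t ∈ Icc t₀ t₁, dmin * ‖wp t‖ ^ 2 ≤ (⟪yp t, wp t⟫_ℂ).re) (hgm : ∀ t ∈ Icc t₀ t₁, dmin * ‖wm t‖ ^ 2 ≤ (⟪ym t, wm t⟫_ℂ).re)
    (hgpp : ∀ t ∈ Icc t₀ t₁, dtwo * ‖wpp t‖ ^ 2 ≤ (⟪ypp t, wpp t⟫_ℂ).re) (hgmm : ∀ t ∈ Icc t₀ t₁, dtwo * ‖wmm t‖ ^ 2 ≤ (⟪ymm t, wmm t⟫_ℂ).re)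
    (hYp : ∀ t ∈ Icc t₀ t₁, ‖yp t‖ ≤ Dmax * ‖wp t‖) (hYm : ∀ t ∈ Icc t₀ t₁, ‖ym t‖ ≤ Dmax * ‖wm t‖)
    (hY0 : ∀ t ∈ Icc t₀ t₁, ‖y0 t‖ ≤ D0 * ‖w0 t‖)
    -- the drain floor, absolute continuity, the chain ODE a.e.
    (hqw : ∀ t ∈ Icc t₀ t₁, q * ‖w0 t‖ ^ 2 ≤ ‖transversalProjR qp (w0 t)‖ ^ 2 + ‖transversalProjR qm (w0 t)‖ ^ 2)
    (h0ac : AbsolutelyContinuousOnInterval w0 t₀ t₁) (hpac : AbsolutelyContinuousOnInterval wp t₀ t₁)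
    (hmac : AbsolutelyContinuousOnInterval wm t₀ t₁)
    (hd0' : ∀ᵐ t, t ∈ uIcc t₀ t₁ → HasDerivAt w0 (dW0R (c * A t) q0 (wp t) (wm t) (y0 t)) t)
    (hdp' : ∀ᵐ t, t ∈ uIcc t₀ t₁ → HasDerivAt wp (dWpR (c * A t) qp (w0 t) (wpp t) (yp t)) t)
    (hdm' : ∀ᵐ t, t ∈ uIcc t₀ t₁ → HasDerivAt wm (dWmR (c * A t) qm (w0 t) (wmm t) (ym t)) t)
    -- the energy and the dissipation split
    (hEac : AbsolutelyContinuousOnInterval E t₀ t₁) (hEd : ∀ᵐ t, t ∈ uIcc t₀ t₁ → HasDerivAt E (-2 * Q t) t)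
    (hE5 : ∀ t ∈ Icc t₀ t₁, μ * (‖w0 t‖ ^ 2 + ‖wp t‖ ^ 2 + ‖wm t‖ ^ 2 + ‖wpp t‖ ^ 2 + ‖wmm t‖ ^ 2) ≤ E t)
    (hQ : ∀ᵐ t, t ∈ uIcc t₀ t₁ →
      μ * ((⟪y0 t, w0 t⟫_ℂ).re + (⟪yp t, wp t⟫_ℂ).re + (⟪ym t, wm t⟫_ℂ).re + (⟪ypp t, wpp t⟫_ℂ).re + (⟪ymm t, wmm t⟫_ℂ).re)
        + (dmin / 2) * (E t - μ * (‖w0 t‖ ^ 2 + ‖wp t‖ ^ 2 + ‖wm t‖ ^ 2 + ‖wpp t‖ ^ 2 + ‖wmm t‖ ^ 2)) ≤ Q t) :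
    E t₁ ≤ Real.exp (-∫ s in t₀..t₁,
        min ((min (ε * c ^ 2 * (q * A s ^ 2 / 2 - 8 * ε / (dmin * (t₁ - t₀) ^ 2))) (min dmin dtwo)) / (9 / 8))
            ((min (ε * c ^ 2 * (q * A s ^ 2 / 2 - 8 * ε / (dmin * (t₁ - t₀) ^ 2))) (min dmin dtwo)) / (7 / 8))) * E t₀ := by
  have ht : t₀ ≤ t₁ := hT.le
  have hIcc : uIcc t₀ t₁ = Icc t₀ t₁ := uIcc_of_le ht
  have hTpos : 0 < t₁ - t₀ := sub_pos.2 hT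
  -- abbreviations
  set P0 : (EuclideanSpace ℂ (Fin 3)) →L[ℂ] (EuclideanSpace ℂ (Fin 3)) := transversalProjR q0 with hP0
  set Y : ℝ → ℝ := fun t => (⟪w0 t, P0 (wp t - wm t)⟫_ℂ).re with hY
  set X : ℝ → ℝ := fun t => (c * A t) * Y t with hX
  set Φ : ℝ → ℝ := fun t => E t + μ * (ε * X t) with hΦ
  set σ : ℝ → ℝ := fun s => min (ε * c ^ 2 * (q * A s ^ 2 / 2 - 8 * ε / (dmin * (t₁ - t₀) ^ 2))) (min dmin dtwo) with hσ
  have hXbR : ∀ t, X t = (⟪w0 t, bR (c * A t) q0 (wp t) (wm t)⟫_ℂ).re := fun t => by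
    rw [hX, hY, re_inner_bR]
  -- (1) the pointwise form inequality at each instant of the slot (`l = c·A t ≤ c`)
  have hform : ∀ t ∈ Icc t₀ t₁,
      -2 * ((⟪y0 t, w0 t⟫_ℂ).re + (⟪yp t, wp t⟫_ℂ).re + (⟪ym t, wm t⟫_ℂ).re + (⟪ypp t, wpp t⟫_ℂ).re + (⟪ymm t, wmm t⟫_ℂ).re)
        + ε * xdotR (c * A t) q0 qp qm (w0 t) (wp t) (wm t) (wpp t) (wmm t) (y0 t) (yp t) (ym t)
      ≤ -(ε * (c * A t) ^ 2 / 2) * (‖transversalProjR qp (w0 t)‖ ^ 2 + ‖transversalProjR qm (w0 t)‖ ^ 2)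
        - (5 * dmin / 4) * (‖wp t‖ ^ 2 + ‖wm t‖ ^ 2) - dtwo * (‖wpp t‖ ^ 2 + ‖wmm t‖ ^ 2) - (7 * d0 / 4) * ‖w0 t‖ ^ 2 := by
    intro t htI
    obtain ⟨hA0t, hA1t⟩ := hA01 t htI
    have hl : 0 ≤ c * A t := mul_nonneg hc hA0t
    have hA2 : (c * A t) ^ 2 ≤ c ^ 2 := by
      rw [mul_pow]; nlinarith [sq_nonneg c, mul_le_one₀ hA1t hA0t hA1t]
    have c1' : 8 * ε * (c * A t) ^ 2 ≤ dmin := by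
      have h := mul_le_mul_of_nonneg_left hA2 (by positivity : 0 ≤ 8 * ε)
      linarith
    have c3' : ε * (c * A t) ^ 2 ≤ dtwo := by
      have h := mul_le_mul_of_nonneg_left hA2 hε
      linarith
    have c4' : 32 * ε ^ 2 * (c * A t) ^ 2 * D0 ^ 2 ≤ d0 * dmin := by
      have h := mul_le_mul_of_nonneg_left hA2 (by positivity : 0 ≤ 32 * ε ^ 2 * D0 ^ 2)
      nlinarith [h, c4]
    exact threeModeR3_form_le (c * A t) ε d0 dmin dmin dtwo dtwo dmin dtwo Dmax D0 q0 qp qm (w0 t) (wp t) (wm t) (wpp t) (wmm t)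
      (y0 t) (yp t) (ym t) (ypp t) (ymm t) (hT0 t htI) (hTyp t htI) (hTym t htI) hl hε hd0 hdmin.le hD0
      (hg0 t htI) (hgp t htI) (hgm t htI) (hgpp t htI) (hgmm t htI) (hYp t htI) (hYm t htI) (hY0 t htI)
      le_rfl le_rfl le_rfl le_rfl c1' c2 c3' c4'
  -- (2) the a.e. derivative of `Φ` and the inequality `Φ' ≤ −σ E`
  have hderiv : ∀ᵐ t, t ∈ uIcc t₀ t₁ → HasDerivAt Φ
      (-2 * Q t + μ * (ε * xdotR (c * A t) q0 qp qm (w0 t) (wp t) (wm t) (wpp t) (wmm t) (y0 t) (yp t) (ym t))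
        + μ * (ε * (c * Ad t) * Y t)) t ∧
      (-2 * Q t + μ * (ε * xdotR (c * A t) q0 qp qm (w0 t) (wp t) (wm t) (wpp t) (wmm t) (y0 t) (yp t) (ym t))
        + μ * (ε * (c * Ad t) * Y t) ≤ -σ t * E t) := by
    filter_upwards [hd0', hdp', hdm', hAd, hAd2, hEd, hQ] with t h0 hp hm hA hA2 hE hQt htI
    have htI' : t ∈ Icc t₀ t₁ := by rwa [hIcc] at htI
    specialize h0 htI; specialize hp htI; specialize hm htI; specialize hA htI; specialize hA2 htI
    specialize hE htI; specialize hQt htI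
    -- derivative of `Y`
    have hg : HasDerivAt (fun s => P0 (wp s - wm s))
        (P0 (dWpR (c * A t) qp (w0 t) (wpp t) (yp t) - dWmR (c * A t) qm (w0 t) (wmm t) (ym t))) t :=
      (P0.restrictScalars ℝ).hasFDerivAt.comp_hasDerivAt t (hp.sub hm)
    have hinner := h0.inner ℂ hg
    have hYd : HasDerivAt Y ((⟪w0 t, P0 (dWpR (c * A t) qp (w0 t) (wpp t) (yp t) - dWmR (c * A t) qm (w0 t) (wmm t) (ym t))⟫_ℂ
            + ⟪dW0R (c * A t) q0 (wp t) (wm t) (y0 t), P0 (wp t - wm t)⟫_ℂ).re) t := by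
      have h := Complex.reCLM.hasFDerivAt.comp_hasDerivAt t hinner
      simpa only [Function.comp_def, Complex.reCLM_apply] using h
    have hXd : HasDerivAt X (c * Ad t * Y t + c * A t *
        ((⟪w0 t, P0 (dWpR (c * A t) qp (w0 t) (wpp t) (yp t) - dWmR (c * A t) qm (w0 t) (wmm t) (ym t))⟫_ℂ
            + ⟪dW0R (c * A t) q0 (wp t) (wm t) (y0 t), P0 (wp t - wm t)⟫_ℂ).re)) t := by
      exact (hA.const_mul c).mul hYd
    have hxdot : c * A t *
        ((⟪w0 t, P0 (dWpR (c * A t) qp (w0 t) (wpp t) (yp t) - dWmR (c * A t) qm (w0 t) (wmm t) (ym t))⟫_ℂ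
            + ⟪dW0R (c * A t) q0 (wp t) (wm t) (y0 t), P0 (wp t - wm t)⟫_ℂ).re)
        = xdotR (c * A t) q0 qp qm (w0 t) (wp t) (wm t) (wpp t) (wmm t) (y0 t) (yp t) (ym t) := by
      rw [Complex.add_re]
      exact l_mul_Ydot_eq_xdotR (c * A t) q0 qp qm (w0 t) (wp t) (wm t) (wpp t) (wmm t) _ _ _
    have hΦd : HasDerivAt Φ (-2 * Q t + μ * (ε * (c * Ad t * Y t
        + xdotR (c * A t) q0 qp qm (w0 t) (wp t) (wm t) (wpp t) (wmm t) (y0 t) (yp t) (ym t)))) t := by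
      have h := hE.add ((hXd.const_mul ε).const_mul μ)
      rw [hxdot] at h
      exact h
    refine ⟨?_, ?_⟩
    · convert hΦd using 1; ring
    · -- the pointwise inequality
      have key := pointwise_slot_ineq (A := A t) (Ad := Ad t) (T := t₁ - t₀) (d0 := d0)
        hμ hε hc hdmin hdtwo hd0 hTpos (hform t htI') (hqw t htI')
        (rampR3_pairing_le q0 (w0 t) (wp t) (wm t)) hA2 (hE5 t htI') hQt
      exact key
  -- (3) sandwich `7E/8 ≤ Φ ≤ 9E/8` on the slot, and `Φ = E` at the ends
  have hεc : ε * c * Real.sqrt 2 / 2 ≤ 1 / 8 := by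
    have hDmax : 0 < Dmax := lt_of_lt_of_le hdmin hdD
    have h32 : 32 * (ε * c) ^ 2 ≤ 1 := by
      have h1 : (8 * ε * c ^ 2) * (4 * ε * Dmax ^ 2) ≤ dmin * dmin :=
        mul_le_mul c1 c2 (by positivity) hdmin.le
      have h2 : dmin * dmin ≤ Dmax * Dmax := mul_le_mul hdD hdD hdmin.le hDmax.le
      have e : (8 * ε * c ^ 2) * (4 * ε * Dmax ^ 2) = (32 * (ε * c) ^ 2) * Dmax ^ 2 := by ring
      have h3 : (32 * (ε * c) ^ 2) * Dmax ^ 2 ≤ 1 * Dmax ^ 2 := by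
        rw [← e]; calc _ ≤ dmin * dmin := h1
          _ ≤ Dmax * Dmax := h2
          _ = 1 * Dmax ^ 2 := by ring
      exact le_of_mul_le_mul_right h3 (by positivity : (0:ℝ) < Dmax ^ 2)
    have hs : Real.sqrt 2 ^ 2 = 2 := Real.sq_sqrt (by norm_num)
    have hnn : 0 ≤ ε * c * Real.sqrt 2 / 2 := by positivity
    have hx : (ε * c * Real.sqrt 2 / 2) ^ 2 ≤ (1 / 8) ^ 2 := by
      have e : (ε * c * Real.sqrt 2 / 2) ^ 2 = (ε * c) ^ 2 * (Real.sqrt 2 ^ 2) / 4 := by ring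
      rw [e, hs]
      linarith
    exact (pow_le_pow_iff_left₀ hnn (by norm_num) two_ne_zero).1 hx
  have hsand : ∀ t ∈ Icc t₀ t₁, |μ * (ε * X t)| ≤ E t / 8 := by
    intro t htI
    obtain ⟨hA0t, hA1t⟩ := hA01 t htI
    have hl : 0 ≤ c * A t := mul_nonneg hc hA0t
    have h3 := threeModeR3_equiv (c * A t) ε q0 (w0 t) (wp t) (wm t) hl hε
    rw [← hXbR t] at h3
    have hE3 : ‖w0 t‖ ^ 2 + ‖wp t‖ ^ 2 + ‖wm t‖ ^ 2 ≤
        ‖w0 t‖ ^ 2 + ‖wp t‖ ^ 2 + ‖wm t‖ ^ 2 + ‖wpp t‖ ^ 2 + ‖wmm t‖ ^ 2 := by linarith [sq_nonneg ‖wpp t‖, sq_nonneg ‖wmm t‖]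
    have hE5t := hE5 t htI
    have hcA : ε * (c * A t) * Real.sqrt 2 ≤ ε * c * Real.sqrt 2 := by
      have h1 : c * A t ≤ c := mul_le_of_le_one_right hc hA1t
      have h2 : ε * (c * A t) ≤ ε * c := mul_le_mul_of_nonneg_left h1 hε
      exact mul_le_mul_of_nonneg_right h2 (Real.sqrt_nonneg 2)
    rw [abs_mul, abs_of_pos hμ]
    have h4 : |ε * X t| ≤ ε * c * Real.sqrt 2 / 2 * (‖w0 t‖ ^ 2 + ‖wp t‖ ^ 2 + ‖wm t‖ ^ 2 + ‖wpp t‖ ^ 2 + ‖wmm t‖ ^ 2) := by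
      have hpos : 0 ≤ ‖w0 t‖ ^ 2 + ‖wp t‖ ^ 2 + ‖wm t‖ ^ 2 := by positivity
      have hk : 0 ≤ ε * c * Real.sqrt 2 := by positivity
      have s1 : ε * (c * A t) * Real.sqrt 2 * (‖w0 t‖ ^ 2 + ‖wp t‖ ^ 2 + ‖wm t‖ ^ 2)
          ≤ ε * c * Real.sqrt 2 * (‖w0 t‖ ^ 2 + ‖wp t‖ ^ 2 + ‖wm t‖ ^ 2) := mul_le_mul_of_nonneg_right hcA hpos
      have s2 : ε * c * Real.sqrt 2 * (‖w0 t‖ ^ 2 + ‖wp t‖ ^ 2 + ‖wm t‖ ^ 2)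
          ≤ ε * c * Real.sqrt 2 * (‖w0 t‖ ^ 2 + ‖wp t‖ ^ 2 + ‖wm t‖ ^ 2 + ‖wpp t‖ ^ 2 + ‖wmm t‖ ^ 2) :=
        mul_le_mul_of_nonneg_left hE3 hk
      linarith [h3, s1, s2]
    calc μ * |ε * X t| ≤ μ * (ε * c * Real.sqrt 2 / 2 * (‖w0 t‖ ^ 2 + ‖wp t‖ ^ 2 + ‖wm t‖ ^ 2 + ‖wpp t‖ ^ 2 + ‖wmm t‖ ^ 2)) :=
          mul_le_mul_of_nonneg_left h4 hμ.le
      _ = ε * c * Real.sqrt 2 / 2 * (μ * (‖w0 t‖ ^ 2 + ‖wp t‖ ^ 2 + ‖wm t‖ ^ 2 + ‖wpp t‖ ^ 2 + ‖wmm t‖ ^ 2)) := by ring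
      _ ≤ 1 / 8 * E t := mul_le_mul hεc hE5t (by positivity) (by norm_num)
      _ = E t / 8 := by ring
  have hlo' : ∀ t ∈ Icc t₀ t₁, 7 / 8 * E t ≤ Φ t := fun t htI => by
    have h := hsand t htI; rw [hΦ]; have := neg_abs_le (μ * (ε * X t)); linarith
  have hhi' : ∀ t ∈ Icc t₀ t₁, Φ t ≤ 9 / 8 * E t := fun t htI => by
    have h := hsand t htI; rw [hΦ]; have := le_abs_self (μ * (ε * X t)); linarith
  have hΦ0 : Φ t₀ = E t₀ := by simp [hΦ, hX, hA0]
  have hΦ1 : Φ t₁ = E t₁ := by simp [hΦ, hX, hA1]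
  -- (4) absolute continuity of `Φ`
  have hYac : AbsolutelyContinuousOnInterval Y t₀ t₁ := by
    have hg : AbsolutelyContinuousOnInterval (fun s => P0 (wp s - wm s)) t₀ t₁ :=
      (hpac.fun_sub hmac).clm_comp (P0.restrictScalars ℝ)
    have h := h0ac.re_inner (𝕜 := ℂ) hg
    simpa only [hY, RCLike.re_to_complex] using h
  have hXac : AbsolutelyContinuousOnInterval X t₀ t₁ := by
    have h := (hAac.const_mul c).fun_mul hYac
    simpa only [hX] using h
  have hΦac : AbsolutelyContinuousOnInterval Φ t₀ t₁ := by
    have h := hEac.fun_add ((hXac.const_mul ε).const_mul μ)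
    simpa only [hΦ] using h
  -- (5) the contraction
  have hσc : Continuous σ := by
    rw [hσ]
    exact ((continuous_const.mul ((continuous_const.mul ((hAc.pow 2))).div_const _ |>.sub continuous_const))).min
      continuous_const
  have hΦd' : ∀ᵐ t, t ∈ uIcc t₀ t₁ → HasDerivAt Φ
      (-2 * Q t + μ * (ε * xdotR (c * A t) q0 qp qm (w0 t) (wp t) (wm t) (wpp t) (wmm t) (y0 t) (yp t) (ym t))
        + μ * (ε * (c * Ad t) * Y t)) t :=
    hderiv.mono fun t ht htI => (ht htI).1
  have hineq : ∀ᵐ t, t ∈ uIcc t₀ t₁ →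
      (-2 * Q t + μ * (ε * xdotR (c * A t) q0 qp qm (w0 t) (wp t) (wm t) (wpp t) (wmm t) (y0 t) (yp t) (ym t))
        + μ * (ε * (c * Ad t) * Y t)) ≤ -σ t * E t :=
    hderiv.mono fun t ht htI => (ht htI).2
  have key := slot_contraction_ac (c₁ := 7 / 8) (c₂ := 9 / 8) ht (by norm_num) (by norm_num) hΦac hΦd' hσc hineq
    hlo' hhi' hΦ0 hΦ1
  simpa [hσ] using key

end Summit.AnomalousDissipation.AnomalousDissipation.Theorems.SolenoidalFractalHomogenisation.LagrangianStep.W7Slot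

end
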